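import Summits.QuantumFields.YangMills.Theorems.BalabanLadderNTCanonicalEnvelopes
import HarnessLib

/-!
# Crux `NT` (stmt-QuantumFields-19353), stub `stub_refpkgT : RefPkgT`: CANONICAL ENVELOPES II — the two-point oscillation
# (E2) term of the registered clause-4 margin is a Riemann sum: `C₂(a/κ)⁴ΣΣ|θv||v|/(1+‖y−x‖)⁴ → (C₂/κ⁴)·∫∫|θv(X)||v(Y)|/‖Y−X‖⁴`

Helper file (`--supports stmt-QuantumFields-19353`) of the fleet lead prover of crux `NT` (unit `ym-spine-19353-p1`,
GEN 12); sequel of `…NTCanonicalEnvelopes` (one-point envelopes `a⁴Σ|v(a x)| → ‖v‖₁`).  Hypothesis-free; pure real analysis on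
the witness side (no gauge field enters).

* `sum_piFinset_two`, `sum_box₂_eq_of_cover`, `tendsto_latticeSum₂_seq`, **`tendsto_latticeSum₂`** — pair Riemann sums:
  for `g` continuous on `(ℝ⁴)²` with `tsupport g ⊆ closedBall 0 ρ`, `a > 0`, `a → 0` (along `ℕ` or along the coupling) and boxes
  with `ρ ≤ a·L` eventually: **`a⁸ Σ_{x,y ∈ box L} g(a x, a y) → ∫ g`** (tree `Sketch.tendsto_riemann_sum`, `N = 2`);
* `one_div_pow_four_sub_le` — `1/m⁴ − 1/(t+m)⁴ ≤ 4t/m⁵` (`m > 0`, `t ≥ 0`): the lattice kernel `(s + ‖Y−X‖)⁻⁴` is within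
  `4s/(2δ)⁵` of the continuum kernel `‖Y−X‖⁻⁴` on pairs `2δ` apart;
* `pairKernel_eq_max`, `continuous_pairKernelMax`, `tsupport_pairKernelMax_subset` — on the pairs charged by a witness with time
  gap `δ` the kernel `|θv(X)||v(Y)|/(t+‖Y−X‖)⁴` equals its `max(‖Y−X‖, 2δ)`-regularisation, which is continuous with compact support;
* **`marginE2_tendsto_canonical`** — along any unit map `a > 0`, `a → 0` and reference tori covering the support,
  `C₂(a/κ)⁴ Σ_xΣ_y |θv(a x)||v(a y)|/(1+‖y−x‖)⁴ → (C₂/κ⁴)·∫_{(ℝ⁴)²} |θv(p₀)||v(p₁)|/‖p₁−p₀‖⁴`;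
* **`margin₂_tendsto_canonical`** — hence the whole registered clause-4 margin converges to the intrinsic number
  **`M₂ᶜᵃⁿ(v) = 2C₁²‖v‖₁²/κ⁸ + (C₂/κ⁴)·∫∫|θv||v|/‖·‖⁴`** (finite: the supports are `2δ` apart).

HONEST FRAMING.  Riemann sums and elementary kernel estimates; nothing about floors, ceilings, AF, NT, the seam or the gap; not
Clay.  Refs: GlimmJaffe1987 §6.1; `…LangevinControlUVOSLegsAtWeakCouplingCStubDensity` (`tendsto_riemann_sum`).
-/

set_option autoImplicit false

noncomputable section

open scoped SchwartzMap
open MeasureTheory Filter Topology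
open Literature.MathematicalPhysics.QuantumFieldTheory Literature.MathematicalPhysics.QuantumLattice
open Literature.Probability.LatticeModels
open Summit.QuantumFields.YangMills.Theorems.OSLegsFromFemtoAndGap (mul_norm_le_norm_smul_siteToE)
open Summit.QuantumFields.YangMills.Cruxes.OSLegsAtWeakCouplingC.Sketch (tendsto_riemann_sum)
open Summit.QuantumFields.YangMills.Cruxes.NT.Reference
  (tsupport_thetaTest_subset_closedBall_zero norm_smul_siteToE_sub smul_siteToE_apply_zero)

namespace Summit.QuantumFields.YangMills.Cruxes.NT.CeilingPrice

/-! ## §1 Pair Riemann sums -/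

section Riemann

/-- Sums over `(Fin 2 → ι)`-indexed boxes are double sums. [folklore] -/
theorem sum_piFinset_two {ι : Type*} [DecidableEq ι] (B : Finset ι) (Φ : (Fin 2 → ι) → ℝ) :
    ∑ p ∈ Fintype.piFinset (fun _ : Fin 2 => B), Φ p = ∑ x ∈ B, ∑ y ∈ B, Φ ![x, y] := by
  rw [← Finset.sum_product (s := B) (t := B) (f := fun q : ι × ι => Φ ![q.1, q.2])]
  refine Finset.sum_equiv (piFinTwoEquiv fun _ => ι) (fun p => ?_) (fun p _ => ?_)
  · simp [Fintype.mem_piFinset, Fin.forall_fin_two, Finset.mem_product]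
  · have : p = ![p 0, p 1] := by ext i; fin_cases i <;> rfl
    exact congrArg Φ this

/-- A pair charged by a function supported in the pi-ball of radius `ρ` (spacing `s > 0`) lies in `box L × box L` once
`ρ ≤ s·L`. [folklore] -/
theorem mem_box₂_of_apply_ne_zero {g : (Fin 2 → EuclideanSpace ℝ (Fin 4)) → ℝ} {ρ s : ℝ} (hs : 0 < s)
    (hg : tsupport g ⊆ Metric.closedBall 0 ρ) {L : ℕ} (hL : ρ ≤ s * L) {x y : Fin 4 → ℤ}
    (hxy : g (fun i => s • siteToE (![x, y] i)) ≠ 0) : x ∈ box 4 L ∧ y ∈ box 4 L := by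
  have hmem := hg (subset_tsupport _ (Function.mem_support.2 hxy))
  rw [Metric.mem_closedBall, dist_zero_right] at hmem
  have key : ∀ z : Fin 4 → ℤ, ‖s • siteToE z‖ ≤ ρ → z ∈ box 4 L := fun z hz => by
    have h1 : s * ‖z‖ ≤ ‖s • siteToE z‖ := mul_norm_le_norm_smul_siteToE hs.le z
    have h3 : ‖z‖ ≤ L := le_of_mul_le_mul_left (by linarith) hs
    refine mem_box.2 fun j => ?_
    have h4 : (‖z j‖ : ℝ) ≤ ‖z‖ := norm_le_pi_norm z j
    rw [Int.norm_eq_abs] at h4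
    have h5 := abs_le.1 (h4.trans h3)
    exact ⟨by exact_mod_cast h5.1, by exact_mod_cast h5.2⟩
  have h0 := norm_le_pi_norm (fun i => s • siteToE (![x, y] i)) 0
  have h1 := norm_le_pi_norm (fun i => s • siteToE (![x, y] i)) 1
  simp only [Matrix.cons_val_zero, Matrix.cons_val_one] at h0 h1
  exact ⟨key x (h0.trans hmem), key y (h1.trans hmem)⟩

/-- **Larger boxes do not change the pair sum** of a function supported in the pi-ball of radius `ρ ≤ s·L`. [folklore] -/
theorem sum_box₂_eq_of_cover {g : (Fin 2 → EuclideanSpace ℝ (Fin 4)) → ℝ} {ρ s : ℝ} (hs : 0 < s)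
    (hg : tsupport g ⊆ Metric.closedBall 0 ρ) {L L' : ℕ} (hL : ρ ≤ s * L) (hLL' : L ≤ L') :
    ∑ x ∈ box 4 L', ∑ y ∈ box 4 L', g (fun i => s • siteToE (![x, y] i)) =
      ∑ x ∈ box 4 L, ∑ y ∈ box 4 L, g (fun i => s • siteToE (![x, y] i)) := by
  have hsub : box 4 L ⊆ box 4 L' := fun z hz => by
    rw [mem_box] at hz ⊢
    intro j
    have := hz j
    constructor <;> [linarith [this.1, (Nat.cast_le (α := ℤ)).2 hLL']; linarith [this.2, (Nat.cast_le (α := ℤ)).2 hLL']]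
  have hzero : ∀ x y : Fin 4 → ℤ, ¬ (x ∈ box 4 L ∧ y ∈ box 4 L) → g (fun i => s • siteToE (![x, y] i)) = 0 := by
    intro x y hn
    by_contra hne
    exact hn (mem_box₂_of_apply_ne_zero hs hg hL hne)
  symm
  refine Finset.sum_subset hsub (fun x _ hx => Finset.sum_eq_zero fun y _ => hzero x y fun h => hx h.1) |>.trans ?_
  refine Finset.sum_congr rfl fun x _ => ?_
  exact Finset.sum_subset hsub fun y _ hy => hzero x y fun h => hy h.2

/-- **Pair Riemann sums along a sequence of spacings, boxes covering the support**: for `g` continuous on `(ℝ⁴)²` with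
`tsupport g ⊆ closedBall 0 ρ`, `a_k > 0`, `a_k → 0`, `ρ ≤ a_k L_k` eventually:
`a_k⁸ Σ_{x,y ∈ box L_k} g(a_k x, a_k y) → ∫ g`. [cite: GlimmJaffe1987, §6.1] -/
theorem tendsto_latticeSum₂_seq {g : (Fin 2 → EuclideanSpace ℝ (Fin 4)) → ℝ} (hgc : Continuous g) {ρ : ℝ}
    (hg : tsupport g ⊆ Metric.closedBall 0 ρ) (a : ℕ → ℝ) (L : ℕ → ℕ) (ha : ∀ k, 0 < a k)
    (ha0 : Tendsto a atTop (𝓝 0)) (hL : ∀ᶠ k in atTop, ρ ≤ a k * L k) :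
    Tendsto (fun k => a k ^ 8 * ∑ x ∈ box 4 (L k), ∑ y ∈ box 4 (L k), g (fun i => a k • siteToE (![x, y] i))) atTop
      (𝓝 (∫ p, g p)) := by
  classical
  have hgK : HasCompactSupport g :=
    (isCompact_closedBall (0 : Fin 2 → EuclideanSpace ℝ (Fin 4)) ρ).of_isClosed_subset (isClosed_tsupport _) hg
  set L' : ℕ → ℕ := fun k => L k + ⌈(k : ℝ) / a k⌉₊ with hL'_def
  have haL' : Tendsto (fun k => a k * L' k) atTop atTop := by
    refine tendsto_atTop_mono (fun k => ?_) tendsto_natCast_atTop_atTop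
    have h1 : (k : ℝ) / a k ≤ ⌈(k : ℝ) / a k⌉₊ := Nat.le_ceil _
    have h2 : (⌈(k : ℝ) / a k⌉₊ : ℝ) ≤ (L' k : ℝ) := by
      rw [hL'_def]; push_cast; linarith [Nat.cast_nonneg (α := ℝ) (L k)]
    calc (k : ℝ) = a k * ((k : ℝ) / a k) := by field_simp [(ha k).ne']
      _ ≤ a k * L' k := mul_le_mul_of_nonneg_left (h1.trans h2) (ha k).le
  have key := tendsto_riemann_sum g hgc hgK a L' ha ha0 haL'
  have hsum : ∀ (b : ℝ) (B : Finset (Fin 4 → ℤ)),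
      ∑ p ∈ Fintype.piFinset (fun _ : Fin 2 => B), g (fun i => b • siteToE (p i)) =
        ∑ x ∈ B, ∑ y ∈ B, g (fun i => b • siteToE (![x, y] i)) := fun b B =>
    sum_piFinset_two B (fun p => g (fun i => b • siteToE (p i)))
  simp_rw [hsum, show 4 * 2 = 8 from rfl] at key
  refine key.congr' ?_
  filter_upwards [hL] with k hk
  rw [sum_box₂_eq_of_cover (ha k) hg hk (Nat.le_add_right _ _)]

/-- **Pair Riemann sums along the coupling**: `a(β)⁸ Σ_{x,y ∈ box (L β)} g(a(β) x, a(β) y) → ∫ g` for `g` continuous with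
`tsupport g ⊆ closedBall 0 ρ`, a unit map `a > 0`, `a → 0` along `atTop : Filter ℝ`, and `ρ ≤ a β·L β` eventually.
[cite: GlimmJaffe1987, §6.1] -/
theorem tendsto_latticeSum₂ {g : (Fin 2 → EuclideanSpace ℝ (Fin 4)) → ℝ} (hgc : Continuous g) {ρ : ℝ}
    (hg : tsupport g ⊆ Metric.closedBall 0 ρ) (a : ℝ → ℝ) (L : ℝ → ℕ) (ha : ∀ β, 0 < a β)
    (ha0 : Tendsto a atTop (𝓝 0)) (hL : ∀ᶠ β in atTop, ρ ≤ a β * L β) :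
    Tendsto (fun β => a β ^ 8 * ∑ x ∈ box 4 (L β), ∑ y ∈ box 4 (L β), g (fun i => a β • siteToE (![x, y] i))) atTop
      (𝓝 (∫ p, g p)) := by
  rw [tendsto_iff_seq_tendsto]
  intro u hu
  exact tendsto_latticeSum₂_seq hgc hg (a ∘ u) (L ∘ u) (fun k => ha _) (ha0.comp hu) (hu.eventually hL)

end Riemann

/-! ## §2 The pair kernel of the E2 term -/

section Kernel

/-- `1/m⁴ − 1/(t+m)⁴ ≤ 4t/m⁵` for `m > 0`, `t ≥ 0`. [folklore] -/
theorem one_div_pow_four_sub_le {m t : ℝ} (hm : 0 < m) (ht : 0 ≤ t) :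
    1 / m ^ 4 - 1 / (t + m) ^ 4 ≤ 4 * t / m ^ 5 := by
  have htm : 0 < t + m := by linarith
  have hm0 : m ≠ 0 := hm.ne'
  have htm0 : t + m ≠ 0 := htm.ne'
  have e : 4 * t / m ^ 5 - (1 / m ^ 4 - 1 / (t + m) ^ 4) =
      t ^ 2 * (10 * m ^ 3 + 20 * m ^ 2 * t + 15 * m * t ^ 2 + 4 * t ^ 3) / (m ^ 5 * (t + m) ^ 4) := by
    field_simp
    ring
  have hnum : 0 ≤ t ^ 2 * (10 * m ^ 3 + 20 * m ^ 2 * t + 15 * m * t ^ 2 + 4 * t ^ 3) / (m ^ 5 * (t + m) ^ 4) := by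
    positivity
  linarith

variable {v : 𝓢(EuclideanSpace ℝ (Fin 4), ℝ)} {δ σ : ℝ}

/-- Pairs charged by `θv`, `v` (time gap `δ`) are `2δ` apart: `2δ ≤ ‖p₁ − p₀‖`. [folklore] -/
theorem two_mul_timeGap_le_norm_sub (hvδ : ∀ y : EuclideanSpace ℝ (Fin 4), v y ≠ 0 → δ ≤ y 0)
    {p₀ p₁ : EuclideanSpace ℝ (Fin 4)} (h₀ : thetaTest 4 v p₀ ≠ 0) (h₁ : v p₁ ≠ 0) : 2 * δ ≤ ‖p₁ - p₀‖ := by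
  rw [thetaTest_apply] at h₀
  have h1 := hvδ _ h₀
  have e : (timeReflection 4 p₀) 0 = -(p₀ 0) := by simp
  rw [e] at h1
  have h2 := hvδ _ h₁
  have h3 : ((p₁ - p₀) 0 : ℝ) ≤ ‖p₁ - p₀‖ := by
    have h := PiLp.norm_apply_le (p₁ - p₀) 0
    rw [Real.norm_eq_abs] at h
    exact (le_abs_self _).trans h
  have h4 : ((p₁ - p₀) 0 : ℝ) = p₁ 0 - p₀ 0 := by simp
  linarith

/-- **The pair kernel equals its regularisation**: for `t ≥ 0` (any `t`), the kernel `|θv(p₀)||v(p₁)|/(t+‖p₁−p₀‖)⁴` of a witness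
with time gap `δ` coincides with `|θv(p₀)||v(p₁)|/(t + max ‖p₁−p₀‖ 2δ)⁴` everywhere. [folklore] -/
theorem pairKernel_eq_max (hvδ : ∀ y : EuclideanSpace ℝ (Fin 4), v y ≠ 0 → δ ≤ y 0) (t : ℝ)
    (p : Fin 2 → EuclideanSpace ℝ (Fin 4)) :
    |thetaTest 4 v (p 0)| * |v (p 1)| / (t + ‖p 1 - p 0‖) ^ 4 =
      |thetaTest 4 v (p 0)| * |v (p 1)| / (t + max ‖p 1 - p 0‖ (2 * δ)) ^ 4 := by
  by_cases h₀ : thetaTest 4 v (p 0) = 0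
  · simp [h₀]
  by_cases h₁ : v (p 1) = 0
  · simp [h₁]
  rw [max_eq_left (two_mul_timeGap_le_norm_sub hvδ h₀ h₁)]

/-- The regularised pair kernel (`t = 0`) is continuous (`δ > 0`). [folklore] -/
theorem continuous_pairKernelMax (hδ : 0 < δ) :
    Continuous fun p : Fin 2 → EuclideanSpace ℝ (Fin 4) =>
      |thetaTest 4 v (p 0)| * |v (p 1)| / (0 + max ‖p 1 - p 0‖ (2 * δ)) ^ 4 := by
  refine Continuous.div ?_ ?_ fun p => ?_
  · exact (((thetaTest 4 v).continuous.comp (continuous_apply 0)).abs).mul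
      ((v.continuous.comp (continuous_apply 1)).abs)
  · exact (continuous_const.add ((((continuous_apply 1).sub (continuous_apply 0)).norm).max
      continuous_const)).pow 4
  · have : 2 * δ ≤ 0 + max ‖p 1 - p 0‖ (2 * δ) := by rw [zero_add]; exact le_max_right _ _
    exact (pow_pos (by linarith) 4).ne'

/-- The regularised pair kernel is supported in the pi-ball of radius `σ` (`σ ≥ 0`, `v` supported in the ball of
radius `σ`). [folklore] -/
theorem tsupport_pairKernelMax_subset (hσ : 0 ≤ σ)
    (hvσ : tsupport (v : EuclideanSpace ℝ (Fin 4) → ℝ) ⊆ Metric.closedBall 0 σ) (t : ℝ) :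
    tsupport (fun p : Fin 2 → EuclideanSpace ℝ (Fin 4) =>
        |thetaTest 4 v (p 0)| * |v (p 1)| / (t + max ‖p 1 - p 0‖ (2 * δ)) ^ 4) ⊆ Metric.closedBall 0 σ := by
  refine closure_minimal (fun p hp => ?_) Metric.isClosed_closedBall
  have h₀ : thetaTest 4 v (p 0) ≠ 0 := fun h => hp (by simp [h])
  have h₁ : v (p 1) ≠ 0 := fun h => hp (by simp [h])
  have hb₀ := tsupport_thetaTest_subset_closedBall_zero hvσ (subset_tsupport _ (Function.mem_support.2 h₀))
  have hb₁ := hvσ (subset_tsupport _ (Function.mem_support.2 h₁))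
  rw [Metric.mem_closedBall, dist_zero_right] at hb₀ hb₁ ⊢
  refine (pi_norm_le_iff_of_nonneg hσ).2 fun i => ?_
  fin_cases i
  · exact hb₀
  · exact hb₁

/-- **The E2 term of the registered clause-4 margin is canonically `(C₂/κ⁴)·∫∫|θv||v|/‖·‖⁴`.**  For a witness `v` with time
gap `δ > 0` and support in the ball of radius `σ ≥ 0`, along any unit map `a > 0`, `a → 0` and reference tori covering the
support (`σ ≤ a β·L β` eventually):
`C₂(aβ/κ)⁴ Σ_{x,y ∈ box (L β)} |θv(aβ x)||v(aβ y)|/(1+‖y−x‖)⁴ → (C₂/κ⁴)·∫_{(ℝ⁴)²} |θv(p₀)||v(p₁)|/‖p₁−p₀‖⁴`.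
[cite: GlimmJaffe1987, §6.1] -/
theorem marginE2_tendsto_canonical (hδ : 0 < δ) (hσ : 0 ≤ σ)
    (hvδ : ∀ y : EuclideanSpace ℝ (Fin 4), v y ≠ 0 → δ ≤ y 0)
    (hvσ : tsupport (v : EuclideanSpace ℝ (Fin 4) → ℝ) ⊆ Metric.closedBall 0 σ) (a : ℝ → ℝ) (L : ℝ → ℕ)
    (ha : ∀ β, 0 < a β) (ha0 : Tendsto a atTop (𝓝 0)) (hL : ∀ᶠ β in atTop, σ ≤ a β * L β) (C₂ κ : ℝ) :
    Tendsto (fun β => C₂ * (a β / κ) ^ 4 * ∑ x ∈ box 4 (L β), ∑ y ∈ box 4 (L β),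
        |thetaTest 4 v (a β • siteToE x)| * |v (a β • siteToE y)| / (1 + ‖siteToE (y - x)‖) ^ 4) atTop
      (𝓝 (C₂ / κ ^ 4 * ∫ p : Fin 2 → EuclideanSpace ℝ (Fin 4),
        |thetaTest 4 v (p 0)| * |v (p 1)| / ‖p 1 - p 0‖ ^ 4)) := by
  -- the regularised kernels `H t`
  set H : ℝ → (Fin 2 → EuclideanSpace ℝ (Fin 4)) → ℝ := fun t p =>
    |thetaTest 4 v (p 0)| * |v (p 1)| / (t + max ‖p 1 - p 0‖ (2 * δ)) ^ 4 with hH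
  -- (1) the lattice term is `(C₂/κ⁴) · a⁸ ΣΣ H_a`
  have hlat : ∀ β, C₂ * (a β / κ) ^ 4 * ∑ x ∈ box 4 (L β), ∑ y ∈ box 4 (L β),
      |thetaTest 4 v (a β • siteToE x)| * |v (a β • siteToE y)| / (1 + ‖siteToE (y - x)‖) ^ 4 =
      C₂ / κ ^ 4 * (a β ^ 8 * ∑ x ∈ box 4 (L β), ∑ y ∈ box 4 (L β),
        H (a β) (fun i => a β • siteToE (![x, y] i))) := by
    intro β
    have hs := ha β
    rw [Finset.mul_sum, Finset.mul_sum, Finset.mul_sum]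
    refine Finset.sum_congr rfl fun x _ => ?_
    rw [Finset.mul_sum, Finset.mul_sum, Finset.mul_sum]
    refine Finset.sum_congr rfl fun y _ => ?_
    have e1 : H (a β) (fun i => a β • siteToE (![x, y] i)) =
        |thetaTest 4 v (a β • siteToE x)| * |v (a β • siteToE y)| /
          (a β + ‖a β • siteToE y - a β • siteToE x‖) ^ 4 := by
      simp only [hH, Matrix.cons_val_zero, Matrix.cons_val_one]
      exact (pairKernel_eq_max hvδ (a β) ![a β • siteToE x, a β • siteToE y]).symm
    rw [e1, norm_smul_siteToE_sub (a β) hs x y]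
    have hden : 0 < 1 + ‖siteToE (y - x)‖ := by positivity
    field_simp
  simp_rw [hlat]
  refine Tendsto.const_mul _ ?_
  -- (2) the regularised continuum kernel `H 0` is a Riemann limit
  have hmain : Tendsto (fun β => a β ^ 8 * ∑ x ∈ box 4 (L β), ∑ y ∈ box 4 (L β),
      H 0 (fun i => a β • siteToE (![x, y] i))) atTop (𝓝 (∫ p, H 0 p)) :=
    tendsto_latticeSum₂ (continuous_pairKernelMax hδ) (tsupport_pairKernelMax_subset hσ hvσ 0) a L ha ha0 hL
  have hint : ∫ p, H 0 p = ∫ p : Fin 2 → EuclideanSpace ℝ (Fin 4), |thetaTest 4 v (p 0)| * |v (p 1)| / ‖p 1 - p 0‖ ^ 4 := by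
    refine integral_congr_ae (Eventually.of_forall fun p => ?_)
    have h := pairKernel_eq_max hvδ 0 p
    simp only [zero_add] at h
    simp only [hH, zero_add]
    exact h.symm
  rw [← hint]
  -- (3) the error `a⁸ ΣΣ (H 0 − H a)` is at most `(4a/(2δ)⁵)·(a⁴S_θ)(a⁴S_v) → 0`
  have herr : Tendsto (fun β => a β ^ 8 * ∑ x ∈ box 4 (L β), ∑ y ∈ box 4 (L β),
      H 0 (fun i => a β • siteToE (![x, y] i)) -
      a β ^ 8 * ∑ x ∈ box 4 (L β), ∑ y ∈ box 4 (L β), H (a β) (fun i => a β • siteToE (![x, y] i))) atTop (𝓝 0) := by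
    have hθ := tendsto_envelope_thetaTest v hvσ a L ha ha0 hL
    have hv := tendsto_envelope v hvσ a L ha ha0 hL
    have hbound : Tendsto (fun β => 4 * a β / (2 * δ) ^ 5 *
        ((a β ^ 4 * ∑ x ∈ box 4 (L β), |thetaTest 4 v (a β • siteToE x)|) *
          (a β ^ 4 * ∑ y ∈ box 4 (L β), |v (a β • siteToE y)|))) atTop (𝓝 0) := by
      have h1 : Tendsto (fun β => 4 * a β / (2 * δ) ^ 5) atTop (𝓝 (4 * 0 / (2 * δ) ^ 5)) :=
        (ha0.const_mul 4).div_const _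
      rw [mul_zero, zero_div] at h1
      simpa using h1.mul (hθ.mul hv)
    refine squeeze_zero_norm' (Eventually.of_forall fun β => ?_) hbound
    have hs := ha β
    rw [Real.norm_eq_abs, ← mul_sub, ← Finset.sum_sub_distrib]
    simp_rw [← Finset.sum_sub_distrib]
    have hpt : ∀ x y : Fin 4 → ℤ, |H 0 (fun i => a β • siteToE (![x, y] i)) - H (a β) (fun i => a β • siteToE (![x, y] i))|
        ≤ 4 * a β / (2 * δ) ^ 5 * (|thetaTest 4 v (a β • siteToE x)| * |v (a β • siteToE y)|) := by
      intro x y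
      simp only [hH, Matrix.cons_val_zero, Matrix.cons_val_one, zero_add]
      set m := max ‖a β • siteToE y - a β • siteToE x‖ (2 * δ) with hm
      have hm2 : 2 * δ ≤ m := le_max_right _ _
      have hm0 : 0 < m := by linarith
      set A := |thetaTest 4 v (a β • siteToE x)| * |v (a β • siteToE y)| with hA
      have hA0 : 0 ≤ A := by positivity
      rw [div_eq_mul_one_div A, div_eq_mul_one_div A (_ ^ 4), ← mul_sub]
      rw [abs_of_nonneg (mul_nonneg hA0 (by
        rw [sub_nonneg]
        exact one_div_le_one_div_of_le (pow_pos hm0 4) (pow_le_pow_left₀ hm0.le (by linarith) 4)))]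
      rw [mul_comm (4 * a β / (2 * δ) ^ 5) A]
      refine mul_le_mul_of_nonneg_left ?_ hA0
      calc 1 / m ^ 4 - 1 / (a β + m) ^ 4 ≤ 4 * a β / m ^ 5 := one_div_pow_four_sub_le hm0 hs.le
        _ ≤ 4 * a β / (2 * δ) ^ 5 :=
            div_le_div_of_nonneg_left (by linarith) (pow_pos (by linarith) 5) (pow_le_pow_left₀ (by linarith) hm2 5)
    calc |a β ^ 8 * ∑ x ∈ box 4 (L β), ∑ y ∈ box 4 (L β),
          (H 0 (fun i => a β • siteToE (![x, y] i)) - H (a β) (fun i => a β • siteToE (![x, y] i)))|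
        = a β ^ 8 * |∑ x ∈ box 4 (L β), ∑ y ∈ box 4 (L β),
          (H 0 (fun i => a β • siteToE (![x, y] i)) - H (a β) (fun i => a β • siteToE (![x, y] i)))| := by
          rw [abs_mul, abs_of_pos (pow_pos hs 8)]
      _ ≤ a β ^ 8 * ∑ x ∈ box 4 (L β), ∑ y ∈ box 4 (L β),
          4 * a β / (2 * δ) ^ 5 * (|thetaTest 4 v (a β • siteToE x)| * |v (a β • siteToE y)|) := by
          refine mul_le_mul_of_nonneg_left ?_ (pow_nonneg hs.le 8)
          refine (Finset.abs_sum_le_sum_abs _ _).trans (Finset.sum_le_sum fun x _ => ?_)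
          exact (Finset.abs_sum_le_sum_abs _ _).trans (Finset.sum_le_sum fun y _ => hpt x y)
      _ = 4 * a β / (2 * δ) ^ 5 * ((a β ^ 4 * ∑ x ∈ box 4 (L β), |thetaTest 4 v (a β • siteToE x)|) *
          (a β ^ 4 * ∑ y ∈ box 4 (L β), |v (a β • siteToE y)|)) := by
          have e : ∑ x ∈ box 4 (L β), ∑ y ∈ box 4 (L β),
              4 * a β / (2 * δ) ^ 5 * (|thetaTest 4 v (a β • siteToE x)| * |v (a β • siteToE y)|) =
              4 * a β / (2 * δ) ^ 5 * ((∑ x ∈ box 4 (L β), |thetaTest 4 v (a β • siteToE x)|) *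
                (∑ y ∈ box 4 (L β), |v (a β • siteToE y)|)) := by
            rw [Finset.sum_mul_sum, Finset.mul_sum]
            refine Finset.sum_congr rfl fun x _ => ?_
            rw [Finset.mul_sum]
          rw [e]
          ring
  have := hmain.sub herr
  simp only [sub_sub_cancel, sub_zero] at this
  exact this

/-- **The whole registered clause-4 margin is canonically `M₂ᶜᵃⁿ(v) = 2C₁²‖v‖₁²/κ⁸ + (C₂/κ⁴)∫∫|θv||v|/‖·‖⁴`**: along any
unit map `a > 0`, `a → 0` and reference tori covering the support (`σ ≤ a β·L β` eventually), for a witness `v` with time gap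
`δ > 0` supported in the ball of radius `σ ≥ 0`. [cite: GlimmJaffe1987, §6.1] -/
theorem margin₂_tendsto_canonical (hδ : 0 < δ) (hσ : 0 ≤ σ)
    (hvδ : ∀ y : EuclideanSpace ℝ (Fin 4), v y ≠ 0 → δ ≤ y 0)
    (hvσ : tsupport (v : EuclideanSpace ℝ (Fin 4) → ℝ) ⊆ Metric.closedBall 0 σ) (a : ℝ → ℝ) (L : ℝ → ℕ)
    (ha : ∀ β, 0 < a β) (ha0 : Tendsto a atTop (𝓝 0)) (hL : ∀ᶠ β in atTop, σ ≤ a β * L β) (C₁ C₂ κ : ℝ) :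
    Tendsto (fun β =>
        2 * (C₁ * (a β / κ) ^ 4 * ∑ x ∈ box 4 (L β), |thetaTest 4 v (a β • siteToE x)|) *
            (C₁ * (a β / κ) ^ 4 * ∑ y ∈ box 4 (L β), |v (a β • siteToE y)|) +
          C₂ * (a β / κ) ^ 4 * ∑ x ∈ box 4 (L β), ∑ y ∈ box 4 (L β),
            |thetaTest 4 v (a β • siteToE x)| * |v (a β • siteToE y)| / (1 + ‖siteToE (y - x)‖) ^ 4) atTop
      (𝓝 (2 * C₁ ^ 2 * (∫ y, |v y|) ^ 2 / κ ^ 8 +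
        C₂ / κ ^ 4 * ∫ p : Fin 2 → EuclideanSpace ℝ (Fin 4), |thetaTest 4 v (p 0)| * |v (p 1)| / ‖p 1 - p 0‖ ^ 4)) :=
  (marginKK_tendsto_canonical v hvσ a L ha ha0 hL C₁ κ).add
    (marginE2_tendsto_canonical hδ hσ hvδ hvσ a L ha ha0 hL C₂ κ)

end Kernel

end Summit.QuantumFields.YangMills.Cruxes.NT.CeilingPrice

end
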